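import Summits.BirchSwinnertonDyer.BirchSwinnertonDyer.Theorems.ByReductionTypeAtTwoOrdKatoHalfAtTwoIsoPortEngines
import Summits.BirchSwinnertonDyer.BirchSwinnertonDyer.Theorems.AlignedTransportAtTwoMainConjectureOfRankZeroBSDAtTwoFineRoadTowerImage
import HarnessLib

/-!
# Route ByReductionTypeAtTwo, crux `OrdKatoHalfAtTwoIso` (stmt-BirchSwinnertonDyer-19573), line
# `steinberg-fibre-at-two`: the STEP-2 ELEMENT at `p = 2` via the cubic engine

Seat `cruxlead-stmt-BirchSwinnertonDyer-19573-g0` (LEAD PROVER, MODE LINE), helper W2d.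
HONEST FRAMING (cell bsd-2adic): BSD is not proved; the crux `OrdKatoHalfAtTwoIso` is not proved; `stub_port`
is not proved here. Theorems only (no definition, no named fact, no `sorry`);
`--supports stmt-BirchSwinnertonDyer-19573 --as helper`.

WHY. STEP 2 of the `μ`-transfer core needs, for a normal `H ⊴ Γ_ℚ` acting trivially on the two twists
`𝒯_J(E, κ) = W.modPTwist p κ J`, `𝒯_{J'}(E, κ')`, every `σ₁ ∈ H` and every joint value `w ∈ (φ, ψ)(H)` of two
continuous 1-cocycles, an element `σ ∈ H` with `(φ σ, ψ σ) = w` AND `κ σ = κ σ₁`. At odd `p` this is the tree's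
`exists_mem_apply_eq_and_apply_eq_of_ne_two` (`…X9StepTwoElement.lean` §3), whose engine is a CENTRAL SCALAR
`σ₀ ∈ ker κ` acting on `E[p]` as `a ≠ 1` — which does not exist at `p = 2` (`GL₂(𝔽₂) ≅ S₃` has trivial centre).
At `p = 2` the scalar is replaced by a FIXED-POINT-FREE `z ∈ ker κ` (a `3`-cycle on `E[2]`, which exists as soon
as `E[2]` is irreducible: `TowerImage.exists_fpf_mem_kerSubgroup_of_irreducible`, `p = 2 ≠ 3`), and the scalar
engine by the CUBIC engine `JointValue.exists_mem_map_eq_apply_eq_of_cubic` (`…PortEngines.lean` E2′), whose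
inputs `hzX` / `hzY` — `z (z x − x) = x` on the twists — are discharged here:

* `rho_apply_rho_sub_eq_of_fpf` (H10): `z ∈ ker κ` acts on `𝒯_J(E)` slotwise through `E[2]`
  (`modPTwist_apply_of_mem_kerSubgroup`), and slotwise Klein rigidity (`AtTwo.smul_smul_sub_eq_self_of_fpf`,
  `#E[2] = 4`, `P + P = 0`) gives `z (z x − x) = x`.
* `exists_mem_apply_eq_and_apply_eq_two` (H11): the `p = 2` twin of `exists_mem_apply_eq_and_apply_eq_of_ne_two`
  (same shape, binder `hirr` instead of `hp2`/`hns`), for `κ` any `ℤ₂`-extension of `ℚ` and `κ'` with the same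
  kernel; `χ = κ` centralises `z` because `Multiplicative ℤ₂` is commutative.

Credit: statements H10/H11 are the ideator's, scratch file `sidea-stub_port-1/StubPortHelpersAtTwo.lean`
(sidea-stub_port-1 STUB-IDEAS-1 @82c64e14eec0e2be, engine E2; lead's PORT-MAP (P4)).

References: J.-P. Serre, Invent. Math. 15 (1972) §5.3 (`GL₂(𝔽₂) ≅ S₃`) [Serre1972]; J.-P. Serre, *Corps locaux*
(1979) VII §5 Prop. 3 [SerreLocalFields1979]; L. Washington, *Cyclotomic Fields* (1997) §13.1 [Washington1997];
the tree's `…X9StepTwoElement.lean` §1/§3, `…PortEngines.lean` E2/H3, `…FineRoadTowerImage.lean` §3.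
-/

set_option autoImplicit false
set_option linter.dupNamespace false

noncomputable section

open Field WeierstrassCurve Literature.NumberTheory.EllipticCurves
  Literature.NumberTheory.GaloisRepresentations Function

namespace Summit.BirchSwinnertonDyer.BirchSwinnertonDyer.Rank1Residual

section RatTwo

variable (W : WeierstrassCurve ℚ) [W.IsElliptic] (κ κ' : ZpExtension ℚ 2)

/-- **H10 (discharging `hzX` of the cubic engine on `𝒯_J(E)` at `p = 2`).** An element `z ∈ ker κ` acts on
`W.modPTwist 2 κ J` slotwise through `E[2]` (the twist character is trivial on `ker κ`); if `z` has no
non-zero fixed point on `E[2]` (a `3`-cycle of `Aut(E[2]) ≅ S₃`, so `z² + z + 1 = 0`) then `z (z x − x) = x`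
on the whole twist (Klein rigidity slotwise). [cite: Serre1972, §5.3] -/
theorem rho_apply_rho_sub_eq_of_fpf (J : ℕ) {z : absoluteGaloisGroup ℚ} (hz : z ∈ κ.kerSubgroup)
    (hfpf : ∀ v : geomTorsion W ((2 : ℕ) : ℤ), z • v = v → v = 0)
    (x : (W.modPTwist 2 κ J).toTopRep) :
    (W.modPTwist 2 κ J).toTopRep.ρ z ((W.modPTwist 2 κ J).toTopRep.ρ z x - x) = x := by
  -- `ρ_𝒯(z)` is coordinatewise `z` on `ker κ`
  have hρ : ∀ y : (W.modPTwist 2 κ J).toTopRep,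
      (W.modPTwist 2 κ J).toTopRep.ρ z y = fun i => z • y i :=
    fun y => modPTwist_apply_of_mem_kerSubgroup W 2 κ J hz y
  -- `#E[2] = 4` and `P + P = 0` on `E[2]`
  have h4 : Nat.card (geomTorsion W ((2 : ℕ) : ℤ)) = 4 :=
    Summit.BirchSwinnertonDyer.BirchSwinnertonDyer.Theorems.AlignedTransportAtTwoFineRoad.PerfectDescent.natCard_geomTorsion_two_of_two_ne_zero
      W two_ne_zero
  have h2 : ∀ m : geomTorsion W ((2 : ℕ) : ℤ), m + m = 0 :=
    fun m => (two_nsmul m).symm.trans (AddSubgroup.torsionBy.nsmul m)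
  rw [hρ, hρ]
  funext i
  exact AtTwo.smul_smul_sub_eq_self_of_fpf h4 h2 hfpf (x i)

/-- **H11 (the STEP-2 element at `p = 2`; twin of `exists_mem_apply_eq_and_apply_eq_of_ne_two`).** `E/ℚ` with
`E[2]` irreducible; `κ` any `ℤ₂`-extension of `ℚ` and `κ'` one with the same kernel (e.g. the dual twist). Let
`H ⊴ Γ_ℚ` act trivially on `𝒯_J(E, κ)` and `𝒯_{J'}(E, κ')`, `φ`, `ψ` continuous 1-cocycles in these,
`M = (φ, ψ)(H)` their joint value group. Then for every `σ₁ ∈ H` and every `w ∈ M` there is `σ ∈ H` with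
`(φ σ, ψ σ) = w` and `κ σ = κ σ₁`. (Cubic engine E2′ with `z ∈ ker κ` a `3`-cycle on `E[2]` — H10 on both
twists — and `χ = κ`, which centralises `z` since `ℤ₂` is commutative.) [cite: Serre1972, §5.3]
[cite: SerreLocalFields1979, VII §5 Prop. 3] -/
theorem exists_mem_apply_eq_and_apply_eq_two (hirr : W.HasIrreducibleModPGaloisRep 2)
    (hker : κ'.kerSubgroup = κ.kerSubgroup) (J J' : ℕ)
    (φ : contOneCocycles (W.modPTwist 2 κ J).toTopRep)
    (ψ : contOneCocycles (W.modPTwist 2 κ' J').toTopRep)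
    (H : Subgroup (absoluteGaloisGroup ℚ)) [H.Normal]
    (hX : ∀ τ ∈ H, ∀ x : (W.modPTwist 2 κ J).toTopRep, (W.modPTwist 2 κ J).toTopRep.ρ τ x = x)
    (hY : ∀ τ ∈ H, ∀ y : (W.modPTwist 2 κ' J').toTopRep, (W.modPTwist 2 κ' J').toTopRep.ρ τ y = y)
    {σ₁ : absoluteGaloisGroup ℚ} (hσ₁ : σ₁ ∈ H)
    {w : (W.modPTwist 2 κ J).toTopRep × (W.modPTwist 2 κ' J').toTopRep}
    (hw : w ∈ contOneCocycles.jointValueSubgroup φ ψ H hX hY) :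
    ∃ σ ∈ H, κ σ = κ σ₁ ∧ φ.1 σ = w.1 ∧ ψ.1 σ = w.2 := by
  -- a `3`-cycle `z ∈ ker κ = ker κ'` on `E[2]` (`p = 2 ≠ 3`, `E[2]` irreducible)
  obtain ⟨z, hz, hfpf⟩ :=
    Summit.BirchSwinnertonDyer.BirchSwinnertonDyer.Theorems.AlignedTransportAtTwoFineRoad.TowerImage.exists_fpf_mem_kerSubgroup_of_irreducible
      W κ (by decide) two_ne_zero hirr
  have hz' : z ∈ κ'.kerSubgroup := hker ▸ hz
  exact JointValue.exists_mem_map_eq_apply_eq_of_cubic φ ψ H hX hY κ (fun g => mul_comm _ _)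
    (rho_apply_rho_sub_eq_of_fpf W κ J hz hfpf) (rho_apply_rho_sub_eq_of_fpf W κ' J' hz' hfpf) hσ₁ hw

end RatTwo

end Summit.BirchSwinnertonDyer.BirchSwinnertonDyer.Rank1Residual
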